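import Mathlib
import Summits.MatrixMultiplication.MatrixMultiplication.Theorems.SnSubsetDichotomyHyperoctahedralThresholdStubCycleGadget
import Summits.MatrixMultiplication.MatrixMultiplication.Theorems.SnSubsetDichotomyHyperoctahedralThresholdStubPathGadget
import Summits.MatrixMultiplication.MatrixMultiplication.Theorems.SnSubsetDichotomyHyperoctahedralThresholdStubMobiusGadget
import Summits.MatrixMultiplication.MatrixMultiplication.Theorems.SnSubsetDichotomyHyperoctahedralThresholdStubExtract

/-!
# Candidate proof of `stub_assembly` (line `one-scale-dichotomy`, crux stmt-MatrixMultiplication-10883)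

Planner's de-risking sketch (siege planner planner-sgplan-stmt-MatrixMultiplication-10883-altline-0): the ONE-SCALE PACKING stub of
`Cruxes/HyperoctahedralThreshold/Lines/one-scale-dichotomy.lean`, proved sorry-free from the tree theorems `stub_extract`,
`stub_cycleGadget`, `stub_pathGadget`, `stub_mobiusGadget`.  A prover may land it verbatim with
`ledger propose --kind proof --target Summits/MatrixMultiplication/MatrixMultiplication/Theorems/SnSubsetDichotomyHyperoctahedralThresholdStubOneScaleAssembly.lean
 --supports stmt-MatrixMultiplication-10883` (theorem name `stub_assembly`, statement verbatim).
-/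

set_option linter.dupNamespace false

namespace Summit.MatrixMultiplication.MatrixMultiplication.Theorems.HyperoctahedralThreshold

namespace OneScaleAssembly

variable {n k : ℕ}

/-- The point set of a rung-walk `w = (col, p, q)`. -/
def pts (w : (Fin (k + 2) → Fin 3) × (Fin (k + 2) → Fin n) × (Fin (k + 2) → Fin n)) : Finset (Fin n) :=
  Finset.univ.image w.2.1 ∪ Finset.univ.image w.2.2

theorem mem_pts (w : (Fin (k + 2) → Fin 3) × (Fin (k + 2) → Fin n) × (Fin (k + 2) → Fin n)) (v : Fin n) :
    v ∈ pts w ↔ ∃ i, w.2.1 i = v ∨ w.2.2 i = v := by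
  simp only [pts, Finset.mem_union, Finset.mem_image, Finset.mem_univ, true_and]
  constructor
  · rintro (⟨i, hi⟩ | ⟨i, hi⟩)
    · exact ⟨i, Or.inl hi⟩
    · exact ⟨i, Or.inr hi⟩
  · rintro ⟨i, hi | hi⟩
    · exact Or.inl ⟨i, hi⟩
    · exact Or.inr ⟨i, hi⟩

theorem card_pts_le (w : (Fin (k + 2) → Fin 3) × (Fin (k + 2) → Fin n) × (Fin (k + 2) → Fin n)) :
    (pts w).card ≤ 2 * (k + 2) := by
  have h1 : (Finset.univ.image w.2.1).card ≤ k + 2 := by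
    simpa using (Finset.card_image_le (s := (Finset.univ : Finset (Fin (k + 2)))) (f := w.2.1))
  have h2 : (Finset.univ.image w.2.2).card ≤ k + 2 := by
    simpa using (Finset.card_image_le (s := (Finset.univ : Finset (Fin (k + 2)))) (f := w.2.2))
  calc (pts w).card ≤ (Finset.univ.image w.2.1).card + (Finset.univ.image w.2.2).card :=
        Finset.card_union_le _ _
    _ ≤ (k + 2) + (k + 2) := Nat.add_le_add h1 h2
    _ = 2 * (k + 2) := by ring

/-- Members meeting a point set `U` number at most `|U| · D` when every point lies on at most `D` members. -/
theorem card_meeting_le {D : ℕ}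
    (W : Finset ((Fin (k + 2) → Fin 3) × (Fin (k + 2) → Fin n) × (Fin (k + 2) → Fin n)))
    (hdeg : ∀ v : Fin n, (W.filter (fun w => ∃ i, w.2.1 i = v ∨ w.2.2 i = v)).card ≤ D) (U : Finset (Fin n)) :
    (W.filter (fun w => ∃ v ∈ U, ∃ i, w.2.1 i = v ∨ w.2.2 i = v)).card ≤ U.card * D := by
  classical
  calc (W.filter (fun w => ∃ v ∈ U, ∃ i, w.2.1 i = v ∨ w.2.2 i = v)).card
      ≤ (U.biUnion (fun v => W.filter (fun w => ∃ i, w.2.1 i = v ∨ w.2.2 i = v))).card := by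
        apply Finset.card_le_card
        intro w hw
        simp only [Finset.mem_filter] at hw
        obtain ⟨hwW, v, hvU, hi⟩ := hw
        exact Finset.mem_biUnion.2 ⟨v, hvU, Finset.mem_filter.2 ⟨hwW, hi⟩⟩
    _ ≤ ∑ v ∈ U, (W.filter (fun w => ∃ i, w.2.1 i = v ∨ w.2.2 i = v)).card := Finset.card_biUnion_le
    _ ≤ ∑ _v ∈ U, D := Finset.sum_le_sum (fun v _ => hdeg v)
    _ = U.card * D := by rw [Finset.sum_const, smul_eq_mul]

/-- GREEDY selection of `G` members with pairwise disjoint point sets. -/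
theorem select {D : ℕ}
    (W : Finset ((Fin (k + 2) → Fin 3) × (Fin (k + 2) → Fin n) × (Fin (k + 2) → Fin n)))
    (hdeg : ∀ v : Fin n, (W.filter (fun w => ∃ i, w.2.1 i = v ∨ w.2.2 i = v)).card ≤ D) :
    ∀ G : ℕ, 2 * (k + 2) * D * G < W.card →
      ∃ ws : Fin G → (Fin (k + 2) → Fin 3) × (Fin (k + 2) → Fin n) × (Fin (k + 2) → Fin n),
        (∀ j, ws j ∈ W) ∧ (∀ j j', j ≠ j' → Disjoint (pts (ws j)) (pts (ws j'))) := by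
  intro G
  induction G with
  | zero => intro _; exact ⟨Fin.elim0, fun j => j.elim0, fun j => j.elim0⟩
  | succ G ih =>
    intro hbig
    classical
    have hbig' : 2 * (k + 2) * D * G + 2 * (k + 2) * D ≤ W.card := by
      have : 2 * (k + 2) * D * (G + 1) = 2 * (k + 2) * D * G + 2 * (k + 2) * D := by ring
      rw [this] at hbig
      exact hbig.le
    obtain ⟨ws, hws, hdisj⟩ := ih (lt_of_le_of_lt (Nat.mul_le_mul_left _ (Nat.le_succ G)) hbig)
    set U : Finset (Fin n) := Finset.univ.biUnion (fun j => pts (ws j)) with hU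
    have hUcard : U.card ≤ G * (2 * (k + 2)) := by
      calc U.card ≤ ∑ j, (pts (ws j)).card := Finset.card_biUnion_le
        _ ≤ ∑ _j : Fin G, 2 * (k + 2) := Finset.sum_le_sum (fun j _ => card_pts_le (ws j))
        _ = G * (2 * (k + 2)) := by simp
    have hlt : (W.filter (fun w => ∃ v ∈ U, ∃ i, w.2.1 i = v ∨ w.2.2 i = v)).card < W.card := by
      calc (W.filter (fun w => ∃ v ∈ U, ∃ i, w.2.1 i = v ∨ w.2.2 i = v)).card ≤ U.card * D :=
            card_meeting_le W hdeg U
        _ ≤ G * (2 * (k + 2)) * D := Nat.mul_le_mul_right _ hUcard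
        _ = 2 * (k + 2) * D * G := by ring
        _ < W.card := by
            have hD : 2 * (k + 2) * D * G < 2 * (k + 2) * D * G + 1 := Nat.lt_succ_self _
            -- if D = 0 then W would have to be nonempty anyway: use hbig directly
            rcases Nat.eq_zero_or_pos D with hD0 | hDpos
            · subst hD0
              simpa using hbig
            · have : 1 ≤ 2 * (k + 2) * D := Nat.one_le_iff_ne_zero.2 (by positivity)
              omega
    -- a member of `W` meeting no point of `U`
    have hex : ∃ w ∈ W, ∀ v ∈ U, ¬ ∃ i, w.2.1 i = v ∨ w.2.2 i = v := by
      by_contra hcon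
      push Not at hcon
      apply lt_irrefl W.card
      calc W.card ≤ (W.filter (fun w => ∃ v ∈ U, ∃ i, w.2.1 i = v ∨ w.2.2 i = v)).card := by
            apply Finset.card_le_card
            intro w hw
            obtain ⟨v, hvU, i, hi⟩ := hcon w hw
            exact Finset.mem_filter.2 ⟨hw, v, hvU, i, hi⟩
        _ < W.card := hlt
    obtain ⟨w, hwW, hwU⟩ := hex
    have hnew : ∀ j, Disjoint (pts w) (pts (ws j)) := by
      intro j
      rw [Finset.disjoint_left]
      intro v hv hv'
      have hvU : v ∈ U := Finset.mem_biUnion.2 ⟨j, Finset.mem_univ _, hv'⟩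
      exact hwU v hvU ((mem_pts w v).1 hv)
    refine ⟨Fin.cons w ws, ?_, ?_⟩
    · intro j
      refine Fin.cases ?_ (fun j => ?_) j
      · simpa using hwW
      · simpa using hws j
    · intro j j'
      refine Fin.cases ?_ (fun i => ?_) j
      · refine Fin.cases (fun h => absurd rfl h) (fun i' _ => ?_) j'
        simpa using hnew i'
      · refine Fin.cases (fun _ => ?_) (fun i' h => ?_) j'
        · simpa using (hnew i).symm
        · have hii' : i ≠ i' := fun e => h (by rw [e])
          simpa using hdisj i i' hii'

/-- Points of extracted data lie among the walk's points. -/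
theorem among_pts {m m' : ℕ} (p q : Fin m → Fin n) (p' q' : Fin m' → Fin n)
    (h : ∀ i, (∃ j, p' i = p j ∨ p' i = q j) ∧ (∃ j, q' i = p j ∨ q' i = q j)) (v : Fin n)
    (hv : ∃ i, v = p' i ∨ v = q' i) : ∃ j, p j = v ∨ q j = v := by
  obtain ⟨i, hi⟩ := hv
  rcases hi with rfl | rfl
  · obtain ⟨j, hj | hj⟩ := (h i).1
    · exact ⟨j, Or.inl hj.symm⟩
    · exact ⟨j, Or.inr hj.symm⟩
  · obtain ⟨j, hj | hj⟩ := (h i).2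
    · exact ⟨j, Or.inl hj.symm⟩
    · exact ⟨j, Or.inr hj.symm⟩

/-- A clean closed rung-walk carries a commuting local triple supported on its points (tree: `stub_extract` + the three gadgets). -/
theorem gadget_of_clean (μ : Fin 3 → Equiv.Perm (Fin n)) (hinv : ∀ c, μ c * μ c = 1) (hfpf : ∀ c v, μ c v ≠ v)
    (w : (Fin (k + 2) → Fin 3) × (Fin (k + 2) → Fin n) × (Fin (k + 2) → Fin n))
    (hw : (∀ i, w.2.1 i ≠ w.2.2 i) ∧ (∀ i, (μ (w.1 i) (w.2.1 i) = w.2.1 (i + 1) ∧ μ (w.1 i) (w.2.2 i) = w.2.2 (i + 1)) ∨ (μ (w.1 i) (w.2.1 i) = w.2.2 (i + 1) ∧ μ (w.1 i) (w.2.2 i) = w.2.1 (i + 1))) ∧ (∀ i, w.1 i ≠ w.1 (i + 1)) ∧ (∀ i j, (w.2.1 i = w.2.1 j ∧ w.2.2 i = w.2.2 j) ∨ (w.2.1 i = w.2.2 j ∧ w.2.2 i = w.2.1 j) ∨ (w.2.1 i ≠ w.2.1 j ∧ w.2.1 i ≠ w.2.2 j ∧ w.2.2 i ≠ w.2.1 j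 ∧ w.2.2 i ≠ w.2.2 j))) :
    ∃ a b : Equiv.Perm (Fin n), (a * a = 1 ∧ b * b = 1 ∧ a * b = b * a ∧ (a ≠ 1 ∨ b ≠ 1) ∧
      a * μ 0 = μ 0 * a ∧ b * μ 1 = μ 1 * b ∧ a * b * μ 2 = μ 2 * (a * b)) ∧
      ∀ v, (a v ≠ v ∨ b v ≠ v) → v ∈ pts w := by
  obtain ⟨hpq, hstep, hcol, heod⟩ := hw
  rcases stub_extract n (k + 1) μ w.2.1 w.2.2 w.1 hinv hfpf hpq hstep hcol heod with
    ⟨k', p', q', col', hp, hq, hpq', hstep', hcol', hamong, -⟩ |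
    ⟨k', p', q', col', hp, hq, hpq', h0, hlast, hstep', hcol', hamong, -⟩ |
    ⟨k', p', q', col', hp, hq, hpq', hstep', hwp, hwq, hcol', hwrap, hamong, -⟩
  · obtain ⟨a, b, h1, h2, h3, h4, h5, h6, h7, hsupp⟩ := stub_cycleGadget n k' μ p' q' col' hinv hp hq hpq' hstep' hcol'
    exact ⟨a, b, ⟨h1, h2, h3, h4, h5, h6, h7⟩,
      fun v hv => (mem_pts w v).2 (among_pts w.2.1 w.2.2 p' q' hamong v (hsupp v hv))⟩
  · obtain ⟨a, b, h1, h2, h3, h4, h5, h6, h7, hsupp⟩ :=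
      stub_pathGadget n k' μ p' q' col' hinv hp hq hpq' h0 hlast hstep' hcol'
    exact ⟨a, b, ⟨h1, h2, h3, h4, h5, h6, h7⟩,
      fun v hv => (mem_pts w v).2 (among_pts w.2.1 w.2.2 p' q' hamong v (hsupp v hv))⟩
  · obtain ⟨a, b, h1, h2, h3, h4, h5, h6, h7, hsupp⟩ :=
      stub_mobiusGadget n k' μ p' q' col' hinv hp hq hpq' hstep' hwp hwq hcol' hwrap
    exact ⟨a, b, ⟨h1, h2, h3, h4, h5, h6, h7⟩,
      fun v hv => (mem_pts w v).2 (among_pts w.2.1 w.2.2 p' q' hamong v (hsupp v hv))⟩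

end OneScaleAssembly

open OneScaleAssembly in
/-- **`stub_assembly`** (line `one-scale-dichotomy`, crux stmt-MatrixMultiplication-10883) — ONE-SCALE PACKING: a family of clean
closed rung-walks with `k + 2` rungs, point-degree `≤ D`, `|W| > 2(k+2)·D·G` ⇒ `G` support-disjoint commuting local triples. -/
theorem stub_assembly : ∀ (n k G D : ℕ) (μ : Fin 3 → Equiv.Perm (Fin n)) (W : Finset ((Fin (k + 2) → Fin 3) × (Fin (k + 2) → Fin n) × (Fin (k + 2) → Fin n))), (∀ c, μ c * μ c = 1) → (∀ c v, μ c v ≠ v) → (∀ w ∈ W, (∀ i, w.2.1 i ≠ w.2.2 i) ∧ (∀ i, (μ (w.1 i) (w.2.1 i) = w.2.1 (i + 1) ∧ μ (w.1 i) (w.2.2 i) = w.2.2 (i + 1)) ∨ (μ (w.1 i) (w.2.1 i) = w.2.2 (i + 1) ∧ μ (w.1 i) (w.2.2 i) = w.2.1 (i + 1))) ∧ (∀ i, w.1 i ≠ w.1 (i + 1)) ∧ (∀ i j, (w.2.1 i = w.2.1 j ∧ w.2.2 i = w.2.2 j) ∨ (w.2.1 i = w.2.2 j ∧ w.2.2 i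 = w.2.1 j) ∨ (w.2.1 i ≠ w.2.1 j ∧ w.2.1 i ≠ w.2.2 j ∧ w.2.2 i ≠ w.2.1 j ∧ w.2.2 i ≠ w.2.2 j))) → (∀ v : Fin n, (W.filter (fun w => ∃ i, w.2.1 i = v ∨ w.2.2 i = v)).card ≤ D) → 2 * (k + 2) * D * G < W.card → ∃ (a b : Fin G → Equiv.Perm (Fin n)), (∀ j, a j * a j = 1 ∧ b j * b j = 1 ∧ a j * b j = b j * a j ∧ (a j ≠ 1 ∨ b j ≠ 1) ∧ a j * μ 0 = μ 0 * a j ∧ b j * μ 1 = μ 1 * b j ∧ a j * b j * μ 2 = μ 2 * (a j * b j)) ∧ (∀ j j' : Fin G, j ≠ j' → ∀ v, (a j v ≠ v ∨ b j v ≠ v) → a j' v = v ∧ b j' v = v) := by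
  intro n k G D μ W hinv hfpf hW hdeg hbig
  obtain ⟨ws, hws, hdisj⟩ := select W hdeg G hbig
  have hg : ∀ j, ∃ a b : Equiv.Perm (Fin n), (a * a = 1 ∧ b * b = 1 ∧ a * b = b * a ∧ (a ≠ 1 ∨ b ≠ 1) ∧
      a * μ 0 = μ 0 * a ∧ b * μ 1 = μ 1 * b ∧ a * b * μ 2 = μ 2 * (a * b)) ∧
      ∀ v, (a v ≠ v ∨ b v ≠ v) → v ∈ pts (ws j) :=
    fun j => gadget_of_clean μ hinv hfpf (ws j) (hW _ (hws j))
  choose a b hab hsupp using hg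
  refine ⟨a, b, hab, fun j j' hjj' v hv => ?_⟩
  have hvj : v ∈ pts (ws j) := hsupp j v hv
  have hd := hdisj j j' hjj'
  constructor
  · by_contra h
    exact Finset.disjoint_left.1 hd hvj (hsupp j' v (Or.inl h))
  · by_contra h
    exact Finset.disjoint_left.1 hd hvj (hsupp j' v (Or.inr h))

end Summit.MatrixMultiplication.MatrixMultiplication.Theorems.HyperoctahedralThreshold
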